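import Literature.AlgebraicGeometry.Motives.WittSchemeSpecialFibreLocus
import Mathlib.AlgebraicGeometry.OpenImmersion
import Mathlib.RingTheory.WittVector.Complete
import Mathlib.Algebra.Ring.GeomSum
import HarnessLib

/-!
# `K(p, k) = W(k)[1/p]` for any field `k`, and the generic fibre of a `W(k)`-scheme is the open
# complement of the special fibre

Let `k` be a commutative ring of characteristic `p` and `W = W(k)` (Mathlib `WittVector p k`).
Mathlib proves the unit criterion "`x₀ ≠ 0 ⇒ x ∈ W(k)ˣ`" only for PERFECT `k`
(`WittVector.isUnit_of_coeff_zero_ne_zero`, via the inverse-coefficient recursion of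
`WittVector/DiscreteValuationRing`). This file proves it for ARBITRARY `k` of characteristic `p`
and draws the consequences used by the `p`-adic files (`Motives/CrystallineRealization`,
`Crystalline/*`) over an arbitrary — possibly imperfect — field `k`; everything is PROVED,
theorems only:

* `isUnit_one_add_verschiebung` — `1 + V z ∈ W(k)ˣ`: the powers `(V z)ⁿ = Vⁿ(…)`
  (`exists_verschiebung_pow_eq_iterate`, from Mathlib `WittVector.iterate_verschiebung_mul`) have
  vanishing components below `n`, so the geometric series `∑ (-V z)ⁱ` stabilises componentwise
  (`truncate_geom_sum_eq`, through the truncation ring maps `W → W_N`) and its componentwise limit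
  is an inverse;
* `isUnit_of_isUnit_coeff_zero` — **`x ∈ W(k)ˣ` as soon as `x₀ ∈ kˣ`** (`x = [x₀] + V w` with the
  Teichmüller unit `[x₀]`, and `[x₀]⁻¹ V w = V(w · F[x₀]⁻¹)`, Mathlib
  `WittVector.verschiebung_mul_frobenius`);
* for a FIELD `k`: `exists_mul_eq_pow_of_ne_zero` — every `x ≠ 0` divides a power of `p`
  (`x = Vⁿ x'` with `x'₀ ≠ 0`, Mathlib `WittVector.verschiebung_nonzero`, and
  `Vⁿ(x') Vⁿ(x'⁻¹) = V²ⁿ(1) = p²ⁿ`), hence **`isLocalization_away_fractionRing`: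
  `K(p, k) = Frac W(k)` is the localization `W(k)[1/p]`** (Mathlib
  `IsLocalization.iff_of_le_of_exists_dvd`);
* geometry, for a `W(k)`-scheme `𝒳` (`SchemeOver (WittVector p k)`) with generic fibre
  `X_K = 𝒳 ×_W Spec K ⟶ 𝒳` (`WittScheme.genericFibre`, `WittScheme.genericFibreι` of
  `Motives/CrystallineRealization`): `isOpenImmersion_specMap_algebraMap_fractionRing`
  (`Spec K ⟶ Spec W` is an open immersion, Mathlib `IsOpenImmersion.of_isLocalization`),
  **`isOpenImmersion_genericFibreι`** (base change), `range_genericFibreι_eq_basicOpen`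
  (`range (X_K ⟶ 𝒳) = D(p) = 𝒳.basicOpen p`), **`range_genericFibreι_eq_compl_range_specialFibreι`**
  (`𝒳 = X_K ⊔ X_k` set-theoretically, with `WittSchemeSpecialFibreLocus`), and
  `exists_iso_basicOpen` (`X_K ≅ 𝒳|_{D(p)}` over `𝒳`, Mathlib `IsOpenImmersion.isoOfRangeEq`).

## Why

The comparison "de Rham cohomology of `𝒳/W` with `p` inverted = de Rham cohomology of the generic
fibre `X_K/K`" (Berthelot–Ogus 1983, (2.4)–(2.5); the glue behind
`Crystalline.HodgeDeRhamDegeneratesModTorsion` and the Berthelot–Ogus maps of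
`CrystallineRealization`) starts from `X_K = 𝒳[1/p] ⊆ 𝒳` being an OPEN subscheme, i.e. from
`K = W[1/p]`; for imperfect `k` this needs the unit criterion proved here.

## References

* J.-P. Serre, *Local Fields*, GTM 67 (1979), II §6 (Witt vectors; units of `W(k)`). [folklore]
* L. Illusie, *Complexe de de Rham–Witt et cohomologie cristalline*, Ann. Sci. ÉNS 12 (1979),
  0 §1.3 (`V`, `F`, `xVy = V(Fx·y)`, the `V`-filtration). [folklore]
* P. Berthelot, A. Ogus, *F-isocrystals and de Rham cohomology. I*, Invent. Math. 72 (1983),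
  (2.4)–(2.5). [BerthelotOgus1983]
-/

open CategoryTheory AlgebraicGeometry Limits Function

universe u

namespace Literature.AlgebraicGeometry.Motives

/-! ### Units of `W(k)` for an arbitrary ring `k` of characteristic `p` -/

section Units

open WittVector

variable {p : ℕ} [Fact p.Prime] {k : Type*} [CommRing k] [CharP k p]

/-- Powers of a Verschiebung are iterated Verschiebungen: `(V z)ⁿ = Vⁿ(a)` for some `a`
(induction on Mathlib `WittVector.iterate_verschiebung_mul`: `Vⁱx · Vʲy = Vⁱ⁺ʲ(Fʲx · Fⁱy)`,
`char k = p`). [folklore] -/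
theorem exists_verschiebung_pow_eq_iterate (z : WittVector p k) (n : ℕ) :
    ∃ a : WittVector p k, (verschiebung z) ^ n = verschiebung^[n] a := by
  induction n with
  | zero => exact ⟨1, by simp⟩
  | succ n ih =>
    obtain ⟨a, ha⟩ := ih
    refine ⟨frobenius^[1] a * frobenius^[n] z, ?_⟩
    rw [pow_succ, ha]
    exact iterate_verschiebung_mul a z n 1

/-- The components of `(V z)ⁿ` below `n` vanish. [folklore] -/
theorem verschiebung_pow_coeff_eq_zero (z : WittVector p k) {n i : ℕ} (hi : i < n) :
    ((verschiebung z) ^ n).coeff i = 0 := by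
  obtain ⟨a, ha⟩ := exists_verschiebung_pow_eq_iterate z n
  rw [ha]
  exact iterate_verschiebung_coeff_eq_zero a hi

/-- `(V z)ⁿ ↦ 0` in the truncated Witt vectors `W_N(k)` for `N ≤ n`. [folklore] -/
theorem truncate_verschiebung_pow_eq_zero (z : WittVector p k) {N n : ℕ} (h : N ≤ n) :
    truncate N ((verschiebung z) ^ n) = 0 :=
  RingHom.mem_ker.mp ((mem_ker_truncate N _).mpr fun _ hi =>
    verschiebung_pow_coeff_eq_zero z (hi.trans_le h))

/-- `(-V z)ⁿ ↦ 0` in `W_N(k)` for `N ≤ n`. [folklore] -/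
theorem truncate_neg_verschiebung_pow_eq_zero (z : WittVector p k) {N n : ℕ} (h : N ≤ n) :
    truncate N ((-verschiebung z) ^ n) = 0 := by
  rw [neg_pow, map_mul, truncate_verschiebung_pow_eq_zero z h, mul_zero]

/-- The truncations of the partial sums `∑_{i<N'} (-V z)ⁱ` of the geometric series stabilise:
in `W_N(k)` they do not depend on `N' ≥ N`. [folklore] -/
theorem truncate_geom_sum_eq (z : WittVector p k) {N N' : ℕ} (h : N ≤ N') :
    truncate N (∑ i ∈ Finset.range N', (-verschiebung z) ^ i) =
      truncate N (∑ i ∈ Finset.range N, (-verschiebung z) ^ i) := by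
  rw [← Finset.sum_range_add_sum_Ico _ h, map_add, add_eq_left, map_sum]
  refine Finset.sum_eq_zero fun i hi => ?_
  rw [Finset.mem_Ico] at hi
  exact truncate_neg_verschiebung_pow_eq_zero z hi.1

/-- **`1 + V z` is a unit of `W(k)`** for every `z`, `k` any ring of characteristic `p`: the Witt
vector `y` whose `i`-th component is that of `∑_{j ≤ i} (-V z)ʲ` satisfies
`(1 + V z) · y ≡ 1 - (-V z)^{i+1} ≡ 1` in every `W_{i+1}(k)` (Serre, *Local Fields* II §6;
Illusie 1979, 0 1.3: `W` is `V`-adically separated and complete). [folklore] -/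
theorem isUnit_one_add_verschiebung (z : WittVector p k) : IsUnit (1 + verschiebung z) := by
  let y : WittVector p k :=
    WittVector.mk p fun i => (∑ j ∈ Finset.range (i + 1), (-verschiebung z) ^ j).coeff i
  have hy : ∀ N, truncate N y = truncate N (∑ j ∈ Finset.range N, (-verschiebung z) ^ j) := by
    intro N
    ext i
    rw [coeff_truncate, coeff_truncate]
    change (∑ j ∈ Finset.range (i.1 + 1), (-verschiebung z) ^ j).coeff i.1 = _
    have h := congrArg (fun t => TruncatedWittVector.coeff ⟨i.1, Nat.lt_succ_self _⟩ t)
      (truncate_geom_sum_eq z (N := i.1 + 1) (N' := N) i.2)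
    simpa only [coeff_truncate] using h.symm
  refine IsUnit.of_mul_eq_one y ?_
  ext i
  have key : truncate (i + 1) ((1 + verschiebung z) * y) = truncate (i + 1) 1 := by
    rw [map_mul, hy, ← map_mul,
      show (1 : WittVector p k) + verschiebung z = 1 - -verschiebung z from (sub_neg_eq_add _ _).symm,
      mul_neg_geom_sum, map_sub, truncate_neg_verschiebung_pow_eq_zero z le_rfl, sub_zero]
  have := congrArg (fun t => TruncatedWittVector.coeff (Fin.last i) t) key
  simpa only [coeff_truncate, Fin.val_last] using this

/-- **Unit criterion in `W(k)`, `k` any ring of characteristic `p`: a Witt vector whose `0`-th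
component is a unit is a unit.** Write `x = [x₀] + V w` with the Teichmüller unit `t = [x₀]`
(Mathlib `WittVector.eq_iterate_verschiebung`); then `x = t · (1 + V(w · F t⁻¹))` by the projection
formula `V(a · F b) = V(a) · b` (Mathlib `WittVector.verschiebung_mul_frobenius`), and `1 + V(…)`
is a unit. (Mathlib `WittVector.isUnit_of_coeff_zero_ne_zero` is the case `k` a perfect field.)
[folklore] -/
theorem isUnit_of_isUnit_coeff_zero (x : WittVector p k) (hx : IsUnit (x.coeff 0)) : IsUnit x := by
  obtain ⟨u, hu⟩ := hx
  set t : WittVector p k := teichmuller p (u : k) with ht_def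
  have ht : IsUnit t := (Units.map (teichmuller p : k →* WittVector p k) u).isUnit
  obtain ⟨tinv, htinv⟩ := ht.exists_right_inv
  have h0 : ∀ i < 1, (x - t).coeff i = 0 := by
    refine le_coeff_eq_iff_le_sub_coeff_eq_zero.mp fun i hi => ?_
    obtain rfl : i = 0 := Nat.lt_one_iff.mp hi
    rw [ht_def, teichmuller_coeff_zero, hu]
  set w : WittVector p k := (x - t).shift 1
  have hw : x - t = verschiebung w := by simpa using eq_iterate_verschiebung h0
  have hx' : x = t * (1 + verschiebung (w * frobenius tinv)) := by
    rw [verschiebung_mul_frobenius, mul_add, mul_one, mul_comm (verschiebung w) tinv, ← mul_assoc,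
      htinv, one_mul, ← hw, add_sub_cancel]
  rw [hx']
  exact ht.mul (isUnit_one_add_verschiebung _)

/-- `Vⁿ(1) = pⁿ` in `W(k)`, `char k = p` (Mathlib `WittVector.iterate_verschiebung_iterate_frobenius`
with `Fⁿ(1) = 1`). [folklore] -/
theorem iterate_verschiebung_one (n : ℕ) :
    verschiebung^[n] (1 : WittVector p k) = (p : WittVector p k) ^ n := by
  have h := iterate_verschiebung_iterate_frobenius (1 : WittVector p k) n
  rwa [iterate_map_one, one_mul] at h

end Units

/-! ### `K(p, k) = W(k)[1/p]` for a field `k` -/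

section Field

open WittVector

variable {p : ℕ} [Fact p.Prime] {k : Type*} [Field k] [CharP k p]

/-- Over a field `k` of characteristic `p` (perfect or not), **every non-zero Witt vector divides a
power of `p`**: `x = Vⁿ(x')` with `x'₀ ≠ 0` (Mathlib `WittVector.verschiebung_nonzero`), `x'` is a
unit (`isUnit_of_isUnit_coeff_zero`), and `Vⁿ(x') · Vⁿ(x'⁻¹) = V²ⁿ(Fⁿx' · Fⁿx'⁻¹) = V²ⁿ(1) = p²ⁿ`.
[folklore] -/
theorem exists_mul_eq_pow_of_ne_zero (x : WittVector p k) (hx : x ≠ 0) :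
    ∃ (y : WittVector p k) (n : ℕ), x * y = (p : WittVector p k) ^ n := by
  obtain ⟨n, x', hx', rfl⟩ := verschiebung_nonzero hx
  obtain ⟨s, hs⟩ := (isUnit_of_isUnit_coeff_zero x' (Ne.isUnit hx')).exists_right_inv
  refine ⟨verschiebung^[n] s, n + n, ?_⟩
  rw [iterate_verschiebung_mul, ← RingHom.coe_pow, ← map_mul, hs, map_one, iterate_verschiebung_one]

/-- **`K(p, k) = W(k)[1/p]`: the fraction field of `W(k)` is its localization away from `p`**, for
ANY field `k` of characteristic `p` (every non-zero element divides a power of `p`,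
`exists_mul_eq_pow_of_ne_zero`; Mathlib `IsLocalization.iff_of_le_of_exists_dvd`). Stated as a
theorem; use `haveI` to make it an instance. [folklore] -/
theorem isLocalization_away_fractionRing :
    IsLocalization.Away (p : WittVector p k) (FractionRing (WittVector p k)) := by
  rw [IsLocalization.Away, IsLocalization.iff_of_le_of_exists_dvd (Submonoid.powers (p : WittVector p k))
    (nonZeroDivisors (WittVector p k))
    (powers_le_nonZeroDivisors_of_noZeroDivisors (WittVector.p_nonzero p k)) fun n hn => ?_]
  · exact Localization.isLocalization
  · obtain ⟨y, m, h⟩ := exists_mul_eq_pow_of_ne_zero n (nonZeroDivisors.ne_zero hn)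
    exact ⟨_, ⟨m, rfl⟩, Dvd.intro y h⟩

/-- `Spec K(p, k) ⟶ Spec W(k)` is an open immersion (it is `D(p) ⊆ Spec W(k)`; Mathlib
`IsOpenImmersion.of_isLocalization`). [folklore] -/
theorem isOpenImmersion_specMap_algebraMap_fractionRing :
    IsOpenImmersion (Spec.map (CommRingCat.ofHom
      (algebraMap (WittVector p k) (FractionRing (WittVector p k))))) :=
  haveI := isLocalization_away_fractionRing (p := p) (k := k)
  IsOpenImmersion.of_isLocalization (p : WittVector p k)

end Field

/-! ### The generic fibre of a `W(k)`-scheme is the open subscheme `D(p)` -/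

namespace WittScheme

variable {p : ℕ} [Fact p.Prime] {k : Type u} [Field k] [CharP k p] (𝒳 : SchemeOver (WittVector p k))

/-- **The generic fibre `X_K ⟶ 𝒳` of a `W(k)`-scheme is an open immersion** (`k` any field of
characteristic `p`): base change of the open immersion `Spec K ⟶ Spec W` (Hartshorne II.3;
Berthelot–Ogus 1983, (2.4)). [folklore] -/
theorem isOpenImmersion_genericFibreι : IsOpenImmersion (genericFibreι 𝒳) := by
  haveI := isOpenImmersion_specMap_algebraMap_fractionRing (p := p) (k := k)
  change IsOpenImmersion (pullback.fst 𝒳.hom (Spec.map (CommRingCat.ofHom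
    (algebraMap (WittVector p k) (FractionRing (WittVector p k))))))
  infer_instance

/-- A point of `𝒳` lies on the generic fibre iff it does NOT lie over `V(p)`, i.e. iff
`p ∉ 𝔭_{f(x)}` for the structure map `f : 𝒳 → Spec W` (Mathlib `Scheme.Pullback.range_fst`,
`PrimeSpectrum.localization_away_comap_range`). [folklore] -/
theorem mem_range_genericFibreι_iff (x : 𝒳.left) :
    x ∈ Set.range (genericFibreι 𝒳) ↔ (p : WittVector p k) ∉ (𝒳.hom x).asIdeal := by
  haveI := isLocalization_away_fractionRing (p := p) (k := k)
  change x ∈ Set.range (pullback.fst 𝒳.hom (Spec.map (CommRingCat.ofHom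
    (algebraMap (WittVector p k) (FractionRing (WittVector p k)))))) ↔ _
  rw [Scheme.Pullback.range_fst, Set.mem_preimage]
  change 𝒳.hom x ∈ Set.range (PrimeSpectrum.comap
    (algebraMap (WittVector p k) (FractionRing (WittVector p k)))) ↔ _
  rw [PrimeSpectrum.localization_away_comap_range (FractionRing (WittVector p k))
    (p : WittVector p k)]
  exact PrimeSpectrum.mem_basicOpen _ _

/-- **`range (X_K ⟶ 𝒳) = D(p) = 𝒳.basicOpen p`**: the generic fibre is the locus where the global
function `p` is invertible. [folklore] -/
theorem range_genericFibreι_eq_basicOpen :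
    Set.range (genericFibreι 𝒳) = (𝒳.left.basicOpen (p : Γ(𝒳.left, ⊤)) : Set 𝒳.left) := by
  ext x
  rw [mem_range_genericFibreι_iff, SetLike.mem_coe, mem_basicOpen_natCast_iff]

/-- **`𝒳 = X_K ⊔ X_k`**: the generic fibre is the complement of the special fibre
(`range_specialFibreι_eq_compl_basicOpen`; Berthelot–Ogus 1983, (2.4)). [folklore] -/
theorem range_genericFibreι_eq_compl_range_specialFibreι :
    Set.range (genericFibreι 𝒳) = (Set.range (specialFibreι 𝒳))ᶜ := by
  rw [range_specialFibreι_eq_compl_basicOpen, compl_compl, range_genericFibreι_eq_basicOpen]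

/-- The image of the generic fibre is open. [folklore] -/
theorem isOpen_range_genericFibreι : IsOpen (Set.range (genericFibreι 𝒳)) := by
  rw [range_genericFibreι_eq_basicOpen]
  exact (𝒳.left.basicOpen (p : Γ(𝒳.left, ⊤))).isOpen

/-- **`X_K ≅ 𝒳|_{D(p)}` over `𝒳`**: the generic fibre is the open subscheme `D(p)` of `𝒳` (two open
immersions with the same image, Mathlib `IsOpenImmersion.isoOfRangeEq`). [folklore] -/
theorem exists_iso_basicOpen :
    ∃ e : (genericFibre 𝒳).left ≅ ↑(𝒳.left.basicOpen (p : Γ(𝒳.left, ⊤))),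
      e.hom ≫ (𝒳.left.basicOpen (p : Γ(𝒳.left, ⊤))).ι = genericFibreι 𝒳 := by
  haveI := isOpenImmersion_genericFibreι 𝒳
  refine ⟨IsOpenImmersion.isoOfRangeEq (genericFibreι 𝒳) (𝒳.left.basicOpen (p : Γ(𝒳.left, ⊤))).ι
    ?_, IsOpenImmersion.isoOfRangeEq_hom_fac _ _ _⟩
  rw [range_genericFibreι_eq_basicOpen, Scheme.Opens.range_ι]

end WittScheme

end Literature.AlgebraicGeometry.Motives
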